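import Summits.CriticalPhenomena.SAWScalingLimit.Theorems.SAWTotalPositivityCriticalBubbleBoundKestenCutMap
import Summits.CriticalPhenomena.SAWScalingLimit.Theorems.CriticalBubbleBound.Negative.CriticalBubbleBoundPolygonSeries

/-!
# Line `kesten-product-renewal-dictionary` (crux stmt-CriticalPhenomena-7117): the two-bridge cut, IV —
the TWO-BRIDGE BOUND `G_{x_c}(0,e₀) ≤ x_c + μ² · Σ_h M₂(h)`

Helper file (lead seat c1). Summation of the cut injection (`cut_injection`, part III): for `n ≥ 2`,
`c_n(0,e₀) x_c^n ≤ μ² · Σ_{(W₁,W₂)} (|W₁|+|W₂|) x_c^{|W₁|} x_c^{|W₂|}`, the sum over apex-meeting,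
apex-only-touching bridge pairs of total length `n + 2` (`countAt_mul_le`); summing over `n` (the term
`n = 1` is `x_c`, even `n` and `n = 0` vanish or are simply bounded) and slicing by the apex column gives
stub A of the line card in the one-number normal form:

  `bubble_le_twoBridge : Negative.bubble e₀ ≤ x_c + μ² · Σ_h disjointPairMass h`.

Hence `Σ_h M₂(h) < ∞ → G_{x_c}(0,e₀) < ∞` (`bubble_ne_top_of_tsum_disjointPairMass_ne_top`), which with
`Negative.criticalBubbleBound_iff_bubble_e₀_ne_top` is the form the line's composition consumes. Sources: the line card (stub A, with the triage's `x_c`-power fix: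
factor `μ²`); Madras–Slade 1993 §1.4 for the series.
-/

noncomputable section

open Literature.Probability.LatticeModels
open Literature.Probability.RandomPlanarGeometry Literature.Probability.RandomPlanarGeometry.SAW
open scoped ENNReal BigOperators
open Summit.CriticalPhenomena.SAWScalingLimit.Theorems.CriticalBubbleBound.Negative
  (e₀ adj_zero_e₀ bubble latticeKernel_zero_eq_tsum_countAt countAt_one_of_adj)

namespace Summit.CriticalPhenomena.SAWScalingLimit.Theorems.CriticalBubbleBound.Kesten.Cut

/-! ## Arithmetic of the critical weights -/

/-- `μ² · x_c^{n+2} = x_c^n` (`x_c = μ⁻¹ > 0`). [folklore] -/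
theorem mu_sq_mul_pow (n : ℕ) : connectiveConstant ^ 2 * criticalFugacity ^ (n + 2) = criticalFugacity ^ n := by
  have hx : 0 < criticalFugacity := criticalFugacity_pos_lt_one'.1
  have hμ : connectiveConstant = criticalFugacity⁻¹ := by
    rw [criticalFugacity, inv_inv]
  rw [hμ, pow_add, inv_pow]
  field_simp

/-- The pair weight of a pair of total length `n + 2` is `(n+2) · x_c^{n+2}`. [folklore] -/
theorem pairWeight_eq_of_len {p : BridgePair} {n : ℕ} (h : p.1.len + p.2.len = n + 2) :
    pairWeight p = ((n + 2 : ℕ) : ℝ≥0∞) * ENNReal.ofReal (criticalFugacity ^ (n + 2)) := by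
  have hx : 0 ≤ criticalFugacity := criticalFugacity_pos_lt_one'.1.le
  rw [pairWeight, Bridge.mass, Bridge.mass, ← ENNReal.ofReal_mul (pow_nonneg hx _), ← pow_add, h,
    ← Nat.cast_add, h]

/-- `μ² · pairWeight = (n+2) · x_c^n` for a pair of total length `n + 2`. [folklore] -/
theorem mu_sq_mul_pairWeight {p : BridgePair} {n : ℕ} (h : p.1.len + p.2.len = n + 2) :
    ENNReal.ofReal (connectiveConstant ^ 2) * pairWeight p =
      ((n + 2 : ℕ) : ℝ≥0∞) * ENNReal.ofReal (criticalFugacity ^ n) := by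
  rw [pairWeight_eq_of_len h, mul_left_comm, ← ENNReal.ofReal_mul (sq_nonneg _), mu_sq_mul_pow]

/-! ## The per-length bound -/

open Classical in
/-- **`c_n(0,e₀) x_c^n ≤ μ² Σ_{pairs of total length n+2} (|W₁|+|W₂|) x_c^{|W₁|+|W₂|}`** (`n ≥ 2`): the cut
injection counts each `n`-step self-avoiding walk `0 → e₀` once among the (pair, root position) data, and
there are `|W₁| + |W₂| = n + 2` admissible root positions per pair. [folklore] -/
theorem countAt_mul_le {n : ℕ} (hn : 2 ≤ n) :
    (Zd.countAt 2 n e₀ : ℝ≥0∞) * ENNReal.ofReal (criticalFugacity ^ n) ≤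
      ENNReal.ofReal (connectiveConstant ^ 2) *
        ∑' p : BridgePair,
          if ApexMeet p ∧ OnlyApex p ∧ p.1.len + p.2.len = n + 2 then pairWeight p else 0 := by
  obtain ⟨Ψ, hinj, hspec⟩ := cut_injection n hn
  set c : ℝ≥0∞ := ENNReal.ofReal (criticalFugacity ^ n) with hc
  -- the weight of a (pair, position) datum
  set G : BridgePair × ℕ → ℝ≥0∞ := fun q =>
    if ApexMeet q.1 ∧ OnlyApex q.1 ∧ q.1.1.len + q.1.2.len = n + 2 ∧ q.2 < n + 2 then c else 0 with hG
  -- LHS as a sum over the walks, pushed forward along the injection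
  have hlhs : (Zd.countAt 2 n e₀ : ℝ≥0∞) * c = ∑ ω ∈ Zd.sawFun 2 n e₀, G (Ψ ω) := by
    rw [Finset.sum_congr rfl fun ω hω => show G (Ψ ω) = c from if_pos (hspec ω hω),
      Finset.sum_const, nsmul_eq_mul, Zd.card_sawFun]
  have hpush : ∑ ω ∈ Zd.sawFun 2 n e₀, G (Ψ ω) ≤ ∑' q : BridgePair × ℕ, G q := by
    rw [← Finset.sum_image fun ω hω ω' hω' h => hinj hω hω' h]
    exact ENNReal.sum_le_tsum _
  -- summing out the root position
  have hpos : ∀ p : BridgePair, ∑' m : ℕ, G (p, m) =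
      ENNReal.ofReal (connectiveConstant ^ 2) *
        (if ApexMeet p ∧ OnlyApex p ∧ p.1.len + p.2.len = n + 2 then pairWeight p else 0) := by
    intro p
    by_cases hp : ApexMeet p ∧ OnlyApex p ∧ p.1.len + p.2.len = n + 2
    · rw [if_pos hp, mu_sq_mul_pairWeight hp.2.2]
      have hGm : ∀ m : ℕ, G (p, m) = Set.indicator (↑(Finset.range (n + 2))) (fun _ => c) m := by
        intro m
        rw [Set.indicator_apply]
        by_cases hm : m < n + 2
        · rw [if_pos (Finset.mem_coe.2 (Finset.mem_range.2 hm))]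
          exact if_pos ⟨hp.1, hp.2.1, hp.2.2, hm⟩
        · rw [if_neg fun h => hm (Finset.mem_range.1 (Finset.mem_coe.1 h))]
          exact if_neg fun h => hm h.2.2.2
      rw [tsum_congr hGm, ← sum_eq_tsum_indicator, Finset.sum_const, Finset.card_range, nsmul_eq_mul]
    · rw [if_neg hp, mul_zero]
      refine ENNReal.tsum_eq_zero.2 fun m => if_neg fun h => hp ⟨h.1, h.2.1, h.2.2.1⟩
  calc (Zd.countAt 2 n e₀ : ℝ≥0∞) * c
      = ∑ ω ∈ Zd.sawFun 2 n e₀, G (Ψ ω) := hlhs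
    _ ≤ ∑' q : BridgePair × ℕ, G q := hpush
    _ = ∑' p : BridgePair, ∑' m : ℕ, G (p, m) := ENNReal.tsum_prod'
    _ = _ := by rw [tsum_congr hpos, ENNReal.tsum_mul_left]

/-! ## Summation over the length and slicing by the apex column -/

/-- `c_0(e₀) = 0`: no zero-step walk from `0` reaches `e₀ ≠ 0`. [folklore] -/
theorem countAt_zero_e₀ : Zd.countAt 2 0 e₀ = 0 := by
  rw [← Zd.card_sawFun, Finset.card_eq_zero, Finset.eq_empty_iff_forall_notMem]
  intro ω hω
  have h0 := apply_zero hω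
  have h1 := apply_of_le hω (le_refl 0)
  rw [h0] at h1
  have := congrFun h1 0
  simp [e₀] at this

open Classical in
/-- Over all lengths: `Σ_{n ≥ 2} c_n(0,e₀) x_c^n ≤ μ² Σ_{pairs} [ApexMeet ∧ OnlyApex] pairWeight`
(each pair has one total length). [folklore] -/
theorem tsum_countAt_mul_le :
    ∑' n : ℕ, (if 2 ≤ n then (Zd.countAt 2 n e₀ : ℝ≥0∞) * ENNReal.ofReal (criticalFugacity ^ n) else 0) ≤
      ENNReal.ofReal (connectiveConstant ^ 2) *
        ∑' p : BridgePair, if ApexMeet p ∧ OnlyApex p then pairWeight p else 0 := by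
  calc ∑' n : ℕ, (if 2 ≤ n then (Zd.countAt 2 n e₀ : ℝ≥0∞) * ENNReal.ofReal (criticalFugacity ^ n) else 0)
      ≤ ∑' n : ℕ, ENNReal.ofReal (connectiveConstant ^ 2) *
          ∑' p : BridgePair,
            if ApexMeet p ∧ OnlyApex p ∧ p.1.len + p.2.len = n + 2 then pairWeight p else 0 := by
        refine ENNReal.tsum_le_tsum fun n => ?_
        by_cases hn : 2 ≤ n
        · rw [if_pos hn]; exact countAt_mul_le hn
        · rw [if_neg hn]; exact zero_le
    _ = ENNReal.ofReal (connectiveConstant ^ 2) * ∑' p : BridgePair, ∑' n : ℕ,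
          if ApexMeet p ∧ OnlyApex p ∧ p.1.len + p.2.len = n + 2 then pairWeight p else 0 := by
        rw [ENNReal.tsum_mul_left, ENNReal.tsum_comm]
    _ ≤ _ := by
        gcongr with p
        by_cases hp : ApexMeet p ∧ OnlyApex p
        · rw [if_pos hp, tsum_eq_single (p.1.len + p.2.len - 2)]
          · split_ifs <;> simp
          · intro n hn
            exact if_neg fun h => hn (by omega)
        · rw [if_neg hp]
          refine le_of_eq (ENNReal.tsum_eq_zero.2 fun n => if_neg fun h => hp ⟨h.1, h.2.1⟩)

open Classical in
/-- Slicing by the apex column: `Σ_{pairs} [ApexMeet ∧ OnlyApex] pairWeight ≤ Σ_h M₂(h)` (every bridge has a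
non-negative span). [folklore] -/
theorem tsum_pairs_le_tsum_disjointPairMass :
    ∑' p : BridgePair, (if ApexMeet p ∧ OnlyApex p then pairWeight p else 0) ≤
      ∑' h : ℕ, disjointPairMass h := by
  have hcomm : ∑' h : ℕ, disjointPairMass h = ∑' p : BridgePair, ∑' h : ℕ,
      if ApexMeet p ∧ AtHeight h p ∧ OnlyApex p then pairWeight p else 0 := by
    simp only [disjointPairMass]
    rw [ENNReal.tsum_comm]
  rw [hcomm]
  refine ENNReal.tsum_le_tsum fun p => ?_
  by_cases hp : ApexMeet p ∧ OnlyApex p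
  · rw [if_pos hp]
    refine le_trans (le_of_eq ?_) (ENNReal.le_tsum p.1.span.toNat)
    have hh : AtHeight p.1.span.toNat p := (Int.toNat_of_nonneg p.1.span_nonneg).symm
    rw [if_pos ⟨hp.1, hh, hp.2⟩]
  · rw [if_neg hp]; exact zero_le

/-- **Two-bridge bound** (stub A of the line `kesten-product-renewal-dictionary`, in the one-number normal
form): `G_{x_c}(0,e₀) ≤ x_c + μ² · Σ_h M₂(h)` — the `n = 1` walk plus the lexicographic two-bridge cut of
the rooted critical polygons. [folklore] -/
theorem bubble_le_twoBridge : bubble e₀ ≤ ENNReal.ofReal criticalFugacity + ENNReal.ofReal (connectiveConstant ^ 2) * ∑' h : ℕ, disjointPairMass h := by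
  classical
  rw [bubble, latticeKernel_zero_eq_tsum_countAt]
  set f : ℕ → ℝ≥0∞ := fun n => (Zd.countAt 2 n e₀ : ℝ≥0∞) * ENNReal.ofReal (criticalFugacity ^ n)
    with hf
  have hsplit : ∀ n : ℕ, f n ≤ (if n = 1 then ENNReal.ofReal criticalFugacity else 0) +
      (if 2 ≤ n then f n else 0) := by
    intro n
    rcases Nat.lt_or_ge n 2 with hn | hn
    · interval_cases n
      · simp [hf, countAt_zero_e₀]
      · simp [hf, countAt_one_of_adj adj_zero_e₀]
    · rw [if_neg (by omega), if_pos hn, zero_add]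
  calc ∑' n, f n
      ≤ ∑' n, ((if n = 1 then ENNReal.ofReal criticalFugacity else 0) + (if 2 ≤ n then f n else 0)) :=
        ENNReal.tsum_le_tsum hsplit
    _ = ENNReal.ofReal criticalFugacity + ∑' n, (if 2 ≤ n then f n else 0) := by
        rw [ENNReal.tsum_add, tsum_ite_eq]
    _ ≤ ENNReal.ofReal criticalFugacity +
          ENNReal.ofReal (connectiveConstant ^ 2) * ∑' h : ℕ, disjointPairMass h := by
        gcongr
        exact tsum_countAt_mul_le.trans (by gcongr; exact tsum_pairs_le_tsum_disjointPairMass)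

/-- Consequently: **if `Σ_h M₂(h) < ∞` then `G_{x_c}(0,e₀) < ∞`** — with the landed one-number normal form
`Negative.criticalBubbleBound_iff_bubble_e₀_ne_top` this is the composition step of the line through stub A.
[folklore] -/
theorem bubble_ne_top_of_tsum_disjointPairMass_ne_top (h : ∑' h : ℕ, disjointPairMass h ≠ ⊤) :
    bubble e₀ ≠ ⊤ :=
  ne_top_of_le_ne_top
    (ENNReal.add_ne_top.2 ⟨ENNReal.ofReal_ne_top, ENNReal.mul_ne_top ENNReal.ofReal_ne_top h⟩)
    bubble_le_twoBridge

end Summit.CriticalPhenomena.SAWScalingLimit.Theorems.CriticalBubbleBound.Kesten.Cut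

end
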